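import Literature.GroupTheory.CombinatorialGroupTheory.AmalgamConjugacyCriterion
import HarnessLib

/-!
# Sliding chains in an amalgam, and the functoriality of letter lists

Topic `Literature/GroupTheory/CombinatorialGroupTheory`; theorems only, continuing
`AmalgamConjugacyCriterion.lean` (letter lists in Mathlib's `Monoid.PushoutI φ`, value `ℓπ[φ] l`).
J. L. Dyer, J. Austral. Math. Soc. (A) 29 (1980) p.38, equations (I)–(II) (after Stebe 1971, Lemma 8):
for alternating products `x = u₁ ⋯ u_k`, `y = v₁ ⋯ v_k`, *"`x ~_H y` if and only if there exists a finite
sequence `h₀, h₁, …, h_k` of elements in `H` such that (I) `h_{i-1} u_i = v_i h_i` … and (II) `h_k = h₀`"*.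
Here the chain is produced and consumed as a LIST of elements of `H`, with every letter equation written
in the amalgam itself (`base h · of u = of v · base h'`), so that no transport between factors is needed:

* `base_mul_lprod_eq_of_chain` — **(I) ⇒ the sliding identity** `base h₀ · ℓπ u = ℓπ v · base h_k` (pure
  algebra, any words, any `φ`);
* `exists_chain_of_lprod_eq` — **the sliding identity ⇒ (I)** for REDUCED words with the same syllable
  pattern and injective `φ`: from `ℓπ v = base h · ℓπ u` a chain `h = h₀, h₁, …, h_k = 1` (iterating the
  one-letter criterion `slide_cons_iff`);
* `lift_lprod` — a family of factor homomorphisms `q i : G i → G₂ i` compatible with `q_H : H → H₂`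
  induces `π : PushoutI φ → PushoutI φ₂` with `π (ℓπ w) = ℓπ (w.map q)` (Dyer p.40: *"the natural projections
  `A → A/M` and `B → B/N` extend to an epimorphism `π_{M,N} : P → P_{M,N}`"*); bookkeeping
  `map_fst_lmap`, `isChain_lmap_iff`, `lmap_rotate`.

## References

* J. L. Dyer, *Separating conjugates in amalgamated free products and HNN extensions*, J. Austral.
  Math. Soc. Ser. A 29 (1980) 35–51, (I)–(II) p.38, p.40. [Dyer1980]
* W. Magnus, A. Karrass, D. Solitar, *Combinatorial Group Theory*, Interscience (1966), §4.2.
  [MagnusKarrassSolitar1966]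
-/

namespace Literature.GroupTheory.CombinatorialGroupTheory

namespace Amalgam

open Monoid Monoid.PushoutI

variable {ι : Type*} {G : ι → Type*} [∀ i, Group (G i)] {H : Type*} [Group H]
  {φ : ∀ i, H →* G i}

/-- The value in `PushoutI φ` of a letter list. -/
local notation3 "ℓπ[" φ "] " l:max =>
  List.prod (List.map (fun x => Monoid.PushoutI.of (φ := φ) (Sigma.fst x) (Sigma.snd x)) l)

/-! ### Chains of sliding equations ⇒ the sliding identity (Dyer (I) ⇒ `x ~_H y`) -/

/-- **A chain of letter equations slides a base element through a word.**  If `hs = [h₀, …, h_k]`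
(`k = |u| = |v|`) satisfies `base h_{i} · of uᵢ = of vᵢ · base h_{i+1}` for every position `i`, then
`base h₀ · ℓπ u = ℓπ v · base h_k`.  Pure algebra: no reducedness, no injectivity.
[cite: Dyer1980, (I)–(II) p.38] -/
theorem base_mul_lprod_eq_of_chain :
    ∀ (u v : List (Σ i, G i)) (hs : List H) (h₀ hk : H),
      hs.length = u.length + 1 → v.length = u.length → hs.head? = some h₀ → hs.getLast? = some hk →
      (∀ (i : ℕ) (za zb : Σ i, G i) (a b : H), u[i]? = some za → v[i]? = some zb →
        hs[i]? = some a → hs[i + 1]? = some b →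
        base φ a * of za.1 za.2 = of zb.1 zb.2 * base φ b) →
      base φ h₀ * ℓπ[φ] u = ℓπ[φ] v * base φ hk := by
  intro u
  induction u with
  | nil =>
    intro v hs h₀ hk hlen hv hh hl _
    have hv' : v = [] := List.length_eq_zero_iff.mp (by simpa using hv)
    subst hv'
    obtain ⟨a, rfl⟩ : ∃ a, hs = [a] := by
      simp only [List.length_nil, zero_add] at hlen
      exact List.length_eq_one_iff.mp hlen
    simp only [List.head?_cons, Option.some.injEq] at hh
    simp only [List.getLast?_singleton, Option.some.injEq] at hl
    subst hh; subst hl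
    simp
  | cons za u ih =>
    intro v hs h₀ hk hlen hv hh hl heq
    obtain ⟨zb, v', rfl⟩ := List.exists_cons_of_ne_nil (l := v) (by rintro rfl; simp at hv)
    obtain ⟨a₀, hs', rfl⟩ := List.exists_cons_of_ne_nil (l := hs) (by rintro rfl; simp at hlen)
    simp only [List.head?_cons, Option.some.injEq] at hh
    -- `hh : a₀ = h₀`
    have hlen' : hs'.length = u.length + 1 := by simpa using hlen
    have hv' : v'.length = u.length := by simpa using hv
    obtain ⟨h₁, hs'', rfl⟩ := List.exists_cons_of_ne_nil (l := hs') (by rintro rfl; simp at hlen')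
    have hl' : (h₁ :: hs'').getLast? = some hk := by
      rwa [List.getLast?_cons_cons] at hl
    -- the first equation and the induction hypothesis
    have e0 : base φ h₀ * of za.1 za.2 = of zb.1 zb.2 * base φ h₁ :=
      heq 0 za zb h₀ h₁ rfl rfl (by rw [← hh]; rfl) rfl
    have ih' := ih v' (h₁ :: hs'') h₁ hk hlen' hv' rfl hl' (fun i za' zb' a b hu hv ha hb =>
      heq (i + 1) za' zb' a b (by simpa using hu) (by simpa using hv) (by simpa using ha)
        (by simpa using hb))
    rw [lprod_cons, lprod_cons]
    calc base φ h₀ * (of za.1 za.2 * ℓπ[φ] u)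
        = (base φ h₀ * of za.1 za.2) * ℓπ[φ] u := by rw [mul_assoc]
      _ = of zb.1 zb.2 * (base φ h₁ * ℓπ[φ] u) := by rw [e0, mul_assoc]
      _ = of zb.1 zb.2 * ℓπ[φ] v' * base φ hk := by rw [ih', mul_assoc]

/-- **A closed chain conjugates**: if moreover `h_k = h₀`, then `ℓπ v = base h₀ · ℓπ u · (base h₀)⁻¹`, so
`ℓπ u` and `ℓπ v` are conjugate (Dyer (II)). [cite: Dyer1980, (I)–(II) p.38] -/
theorem isConj_lprod_of_chain (u v : List (Σ i, G i)) (hs : List H) (h₀ : H)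
    (hlen : hs.length = u.length + 1) (hv : v.length = u.length) (hh : hs.head? = some h₀)
    (hl : hs.getLast? = some h₀)
    (heq : ∀ (i : ℕ) (za zb : Σ i, G i) (a b : H), u[i]? = some za → v[i]? = some zb →
      hs[i]? = some a → hs[i + 1]? = some b → base φ a * of za.1 za.2 = of zb.1 zb.2 * base φ b) :
    IsConj (ℓπ[φ] u) (ℓπ[φ] v) := by
  have e := base_mul_lprod_eq_of_chain u v hs h₀ h₀ hlen hv hh hl heq
  refine isConj_iff.mpr ⟨base φ h₀, ?_⟩
  rw [e, mul_inv_cancel_right]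

/-! ### The sliding identity ⇒ a chain (reduced words, injective `φ`) -/

/-- **Sliding a base element through two reduced words of the same syllable pattern produces a chain**
(Dyer (I)): if `ℓπ v = base h · ℓπ u` with `u`, `v` reduced and `u`, `v` with the same sequence of
factors, there is `hs = [h = h₀, h₁, …, h_k = 1]` with `base hᵢ · of uᵢ = of vᵢ · base h_{i+1}` for all
`i` (the first-letter lemma `slide_cons_iff`, iterated). [cite: Dyer1980, (I)–(II) p.38] -/
theorem exists_chain_of_lprod_eq (hφ : ∀ i, Function.Injective (φ i)) :
    ∀ (u v : List (Σ i, G i)) (h : H),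
      u.IsChain (fun a b => a.1 ≠ b.1) → (∀ z ∈ u, z.2 ∉ (φ z.1).range) →
      v.IsChain (fun a b => a.1 ≠ b.1) → (∀ z ∈ v, z.2 ∉ (φ z.1).range) →
      u.map Sigma.fst = v.map Sigma.fst → ℓπ[φ] v = base φ h * ℓπ[φ] u →
      ∃ hs : List H, hs.length = u.length + 1 ∧ hs.head? = some h ∧ hs.getLast? = some 1 ∧
        ∀ (i : ℕ) (za zb : Σ i, G i) (a b : H), u[i]? = some za → v[i]? = some zb →
          hs[i]? = some a → hs[i + 1]? = some b →
          base φ a * of za.1 za.2 = of zb.1 zb.2 * base φ b := by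
  intro u
  induction u with
  | nil =>
    intro v h _ _ _ _ hfst e
    have hv : v = [] := by simpa using hfst.symm
    subst hv
    have h1 : h = 1 := by
      simp only [List.map_nil, List.prod_nil, mul_one] at e
      exact base_injective hφ (by rw [map_one]; exact e.symm)
    subst h1
    refine ⟨[1], rfl, rfl, rfl, ?_⟩
    intro i za zb a b hu
    simp at hu
  | cons za u ih =>
    intro v h huc hur hvc hvr hfst e
    obtain ⟨zb, v', rfl⟩ := List.exists_cons_of_ne_nil (l := v)
      (by rintro rfl; simp at hfst)
    obtain ⟨j, a⟩ := za
    obtain ⟨j', b⟩ := zb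
    simp only [List.map_cons, List.cons.injEq] at hfst
    obtain ⟨hjj, hfst'⟩ := hfst
    subst hjj
    -- one sliding step
    obtain ⟨h₁, hh₁, e'⟩ := (slide_cons_iff hφ huc hur hvc hvr h).mp e
    obtain ⟨hs', hlen', hh', hl', heq'⟩ :=
      ih v' h₁ huc.tail (fun z hz => hur z (List.mem_cons_of_mem _ hz)) hvc.tail
        (fun z hz => hvr z (List.mem_cons_of_mem _ hz)) hfst' e'
    refine ⟨h :: hs', by simp [hlen'], rfl, ?_, ?_⟩
    · obtain ⟨x, hs'', rfl⟩ := List.exists_cons_of_ne_nil (l := hs') (by rintro rfl; simp at hlen')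
      rw [List.getLast?_cons_cons]; exact hl'
    · intro i za' zb' a' b' hu hv ha hb
      cases i with
      | zero =>
        simp only [List.getElem?_cons_zero, Option.some.injEq] at hu hv ha
        simp only [zero_add] at hb
        rw [List.getElem?_cons_succ, ← List.head?_eq_getElem?, hh'] at hb
        simp only [Option.some.injEq] at hb
        subst hu; subst hv; subst ha; subst hb
        -- `φ h · a = b · φ h₁` read in the amalgam
        change base φ h * of j a = of j b * base φ h₁
        rw [← of_apply_eq_base φ j h, ← of_apply_eq_base φ j h₁, ← map_mul, ← map_mul, hh₁]
      | succ i =>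
        exact heq' i za' zb' a' b' (by simpa using hu) (by simpa using hv) (by simpa using ha)
          (by simpa using hb)

/-! ### Functoriality: compatible factor homomorphisms act letterwise -/

section Functoriality

variable {G₂ : ι → Type*} [∀ i, Group (G₂ i)] {H₂ : Type*} [Group H₂] {φ₂ : ∀ i, H₂ →* G₂ i}
  (qH : H →* H₂) (q : ∀ i, G i →* G₂ i)

/-- The value in `PushoutI φ₂` of a letter list (second amalgam). -/
local notation3 "ℓπ₂ " l:max =>
  List.prod (List.map (fun x => Monoid.PushoutI.of (φ := φ₂) (Sigma.fst x) (Sigma.snd x)) l)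

/-- Compatibility of the factor homomorphisms with the base homomorphism, in the form needed by
`PushoutI.lift`. [cite: Dyer1980, Thm. 4 proof p.40] -/
theorem lift_compat (hq : ∀ i, (q i).comp (φ i) = (φ₂ i).comp qH) (i : ι) :
    ((of (φ := φ₂) i).comp (q i)).comp (φ i) = (base φ₂).comp qH := by
  ext h
  simp only [MonoidHom.comp_apply]
  rw [← MonoidHom.comp_apply (q i) (φ i), hq i, MonoidHom.comp_apply, of_apply_eq_base]

/-- **The induced homomorphism `π : P → P̄` acts letterwise on words**:
`π (ℓπ w) = ℓπ (w.map q)`. [cite: Dyer1980, Thm. 4 proof p.40] -/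
theorem lift_lprod (hq : ∀ i, (q i).comp (φ i) = (φ₂ i).comp qH) (w : List (Σ i, G i)) :
    PushoutI.lift (fun i => (of (φ := φ₂) i).comp (q i)) ((base φ₂).comp qH) (lift_compat qH q hq)
      (ℓπ[φ] w) = ℓπ₂ (w.map fun z => (⟨z.1, q z.1 z.2⟩ : Σ i, G₂ i)) := by
  induction w with
  | nil => simp
  | cons z w ih =>
    rw [lprod_cons, map_mul, ih, List.map_cons, lprod_cons, PushoutI.lift_of]
    rfl

/-- The induced homomorphism on base elements. [cite: Dyer1980, Thm. 4 proof p.40] -/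
theorem lift_base' (hq : ∀ i, (q i).comp (φ i) = (φ₂ i).comp qH) (h : H) :
    PushoutI.lift (fun i => (of (φ := φ₂) i).comp (q i)) ((base φ₂).comp qH) (lift_compat qH q hq)
      (base φ h) = base φ₂ (qH h) := by
  rw [PushoutI.lift_base]; rfl

omit [∀ i, Group (G i)] [∀ i, Group (G₂ i)] in
/-- The letterwise map preserves the sequence of factors (Dyer: *"`π_{M,N}(x)` is a cyclically reduced
alternating product in `P_{M,N}` whose length is equal to `‖x‖`"*). [cite: Dyer1980, Thm. 4 proof p.40] -/
theorem map_fst_lmap (f : ∀ i, G i → G₂ i) (w : List (Σ i, G i)) :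
    (w.map fun z => (⟨z.1, f z.1 z.2⟩ : Σ i, G₂ i)).map Sigma.fst = w.map Sigma.fst := by
  rw [List.map_map]; rfl

omit [∀ i, Group (G i)] [∀ i, Group (G₂ i)] in
/-- The letterwise map preserves alternation. [cite: Dyer1980, Thm. 4 proof p.40] -/
theorem isChain_lmap_iff (f : ∀ i, G i → G₂ i) (w : List (Σ i, G i)) :
    (w.map fun z => (⟨z.1, f z.1 z.2⟩ : Σ i, G₂ i)).IsChain (fun a b => a.1 ≠ b.1) ↔
      w.IsChain (fun a b => a.1 ≠ b.1) := by
  rw [List.isChain_map]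

omit [∀ i, Group (G i)] [∀ i, Group (G₂ i)] in
/-- The letterwise map commutes with rotation (cyclic permutations of `x` map to cyclic permutations of
`π x`). [cite: Dyer1980, Thm. 4 proof p.40] -/
theorem lmap_rotate (f : ∀ i, G i → G₂ i) (w : List (Σ i, G i)) (k : ℕ) :
    (w.rotate k).map (fun z => (⟨z.1, f z.1 z.2⟩ : Σ i, G₂ i)) =
      (w.map fun z => (⟨z.1, f z.1 z.2⟩ : Σ i, G₂ i)).rotate k := by
  rw [List.map_rotate]

omit [∀ i, Group (G i)] [∀ i, Group (G₂ i)] in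
/-- End letters of the letterwise image lie in the same factors (cyclic reducedness is preserved).
[cite: Dyer1980, Thm. 4 proof p.40] -/
theorem ends_lmap (f : ∀ i, G i → G₂ i) {w : List (Σ i, G i)}
    (hcr : ∀ a ∈ w.getLast?, ∀ b ∈ w.head?, a.1 ≠ b.1) :
    ∀ a ∈ (w.map fun z => (⟨z.1, f z.1 z.2⟩ : Σ i, G₂ i)).getLast?,
      ∀ b ∈ (w.map fun z => (⟨z.1, f z.1 z.2⟩ : Σ i, G₂ i)).head?, a.1 ≠ b.1 := by
  intro a ha b hb
  rw [List.getLast?_map, Option.mem_def, Option.map_eq_some_iff] at ha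
  rw [List.head?_map, Option.mem_def, Option.map_eq_some_iff] at hb
  obtain ⟨a', ha', rfl⟩ := ha
  obtain ⟨b', hb', rfl⟩ := hb
  exact hcr a' ha' b' hb'

end Functoriality

end Amalgam

end Literature.GroupTheory.CombinatorialGroupTheory
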